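import Summits.CriticalPhenomena.PercolationContinuityZ3.Theorems.FK.DLRClosedBoundaryFree
import Summits.CriticalPhenomena.PercolationContinuityZ3.Theorems.FK.WiredMinimalOnFiniteClusters
import HarnessLib

/-!
# FK-continuity cell, FO-10a: on the finite clusters the sandwich of `R_{p,q}` is REVERSED —
# `φ¹_{p,q}(A; Λ ↛ ∞) ≤ P(A; Λ ↛ ∞) ≤ φ⁰_{p,q}(A; Λ ↛ ∞)` for every DLR random-cluster measure `P`
# (Grimmett 2006, Prop. (5.30) / proof of Thm. (5.16)(c), coupling-free, for the class `R_{p,q}`)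

Registered R78 (cell INBOX l.5727, 2026-08-23); registry row FO-10a-g336f; label DFR-C (coordinator fk-4 g167).
Cell `fk-continuity` (bschramm), row FO-10a (domain-Markov + comparison layer over FO-06); support file for the
FK-continuity transplant (`--supports stmt-CriticalPhenomena-4575`); builds on p205010 (kernel theorem, internal audit
signed; external expert review pending). Pure proofs; no definitions, no named facts, no sorries; general dimension `d`.

Grimmett's sandwich (4.35) orders `R_{p,q}`: `φ⁰_{p,q} ≤st P ≤st φ¹_{p,q}`. `WiredMinimalOnFiniteClusters.lean` (package
`g336-thetaunique`) proved the lower REVERSED bound `φ¹_{p,q}(A ∩ {Λ ↛ ∞}) ≤ P(A ∩ {Λ ↛ ∞})` for every `P` of the sandwich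
class; with the free Markov property of a DLR measure across a closed edge boundary (`DLRClosedBoundaryFree.lean`) the
free-island decomposition is EXACT for `P ∈ R_{p,q}` as well, and the same decreasing simple function `Σ_g φ⁰_g(A) 1_{G=g}`
integrated against `φ⁰_{p,q} ≤st P` gives the upper reversed bound:

* `IsDLRRandomCluster.real_inter_setOf_forall_not_bdryReach_eq_sum` — `P(A ∩ {Λ ↮ ∂Δ in Δ}) = Σ_g φ⁰_g(A) · P(G = g)`;
* `IsDLRRandomCluster.real_inter_setOf_forall_not_bdryReach_le_rcLimit_false` — `P(A ∩ {Λ ↮ ∂Δ in Δ}) ≤ φ⁰_{p,q}(A ∩ {Λ ↮ ∂Δ in Δ})`;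
* **`IsDLRRandomCluster.real_inter_finiteClusters_le_rcLimit_false`** — `P(A ∩ {Λ ↛ ∞}) ≤ φ⁰_{p,q}(A ∩ {Λ ↛ ∞})`, and
  **`IsDLRRandomCluster.real_inter_finiteClusters_mem_Icc`** — `P(A ∩ {Λ ↛ ∞}) ∈ [φ¹_{p,q}(A ∩ {Λ ↛ ∞}), φ⁰_{p,q}(A ∩ {Λ ↛ ∞})]`
  (`0 < p < 1`, `q ≥ 1`, `P ∈ R_{p,q}` lattice-carried, `A` increasing determined by `E_Λ`): inside finite clusters the free
  measure is the LARGEST and the wired measure the SMALLEST member of `R_{p,q}`.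

Honest framing: unconditional structure; NOT a binder discharge, NOT `_r4`.

## References
* G. Grimmett, *The Random-Cluster Model*, Springer 2006 (`book:grimmett2006-random-cluster-model`): Lemma (4.13), (4.24),
  Def. (4.29)–(4.30), Thm. (4.34) (4.35); §5.2 Prop. (5.30) and the proof of Thm. (5.16)(c) [PDF pp. 71–82, 103–107]. [Grimmett2006]
-/

noncomputable section

open MeasureTheory Set Filter
open scoped Topology ENNReal

namespace Summit.CriticalPhenomena.PercolationContinuityZ3.Theorems.FK

open Literature.Probability.Percolation Literature.Probability.LatticeModels

variable {d : ℕ} {p q : ℝ} {P : Measure (BondConfig (Site d))}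

/-- **Decomposition by the free island, for a DLR measure** (exact): for `P ∈ R_{p,q}` carried by lattice configurations
(`0 < p < 1`, `q > 0`), finite `Λ ⊆ Δ` and `A` determined by `E_Λ`,
`P(A ∩ {Λ ↮ ∂Δ inside Δ}) = Σ_{Λ ⊆ g ⊆ Δ} φ⁰_{g,p,q}(A) · P(G = g)`. [cite: Grimmett2006, Lemma (4.13) inside (4.30), with §5.2 Prop. (5.30)] -/
theorem IsDLRRandomCluster.real_inter_setOf_forall_not_bdryReach_eq_sum (hP : IsDLRRandomCluster d p q P)
    (hE : ∀ᵐ ω ∂P, ω ⊆ (zdGraph d).edgeSet) (hp : p ∈ Set.Ioo (0 : ℝ) 1) (hq : 0 < q) {Λ Δ : Finset (Site d)}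
    (hΛΔ : Λ ⊆ Δ) {A : Set (BondConfig (Site d))} (hAΛ : DeterminedBy A ↑(edgesIn (zdGraph d) Λ)) :
    P.real (A ∩ {ω | ∀ x ∈ Λ, ¬ ∃ y ∈ innerBoundary (zdGraph d) Δ,
        (openGraph ω ⊓ withinGraph (zdGraph d) (↑Δ : Set (Site d))).Reachable y x}) =
      ∑ g ∈ Δ.powerset.filter (fun g => Λ ⊆ g), regionFreeReal d p q g A *
        P.real {ω : BondConfig (Site d) | ∀ x, x ∈ g ↔ x ∈ Δ ∧ ¬ ∃ y ∈ innerBoundary (zdGraph d) Δ,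
          (openGraph ω ⊓ withinGraph (zdGraph d) (↑Δ : Set (Site d))).Reachable y x} := by
  classical
  haveI := hP.isProbabilityMeasure
  set I : Finset (Site d) → Set (BondConfig (Site d)) := fun g =>
    {ω | ∀ x, x ∈ g ↔ x ∈ Δ ∧ ¬ ∃ y ∈ innerBoundary (zdGraph d) Δ,
      (openGraph ω ⊓ withinGraph (zdGraph d) (↑Δ : Set (Site d))).Reachable y x} with hI
  set 𝒢 : Finset (Finset (Site d)) := Δ.powerset.filter (fun g => Λ ⊆ g) with h𝒢
  have hIm : ∀ g, MeasurableSet (I g) := fun g =>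
    measurableSet_of_isLocalEvent_holds ⟨_, determinedBy_setOf_island Δ g⟩
  have hdisj : (↑𝒢 : Set (Finset (Site d))).PairwiseDisjoint I := fun g _ g' _ hne =>
    disjoint_setOf_island Δ hne
  have hdisjA : (↑𝒢 : Set (Finset (Site d))).PairwiseDisjoint (fun g => A ∩ I g) := fun g hg g' hg' hne =>
    (hdisj hg hg' hne).mono Set.inter_subset_right Set.inter_subset_right
  have hAm : MeasurableSet A := measurableSet_of_isLocalEvent_holds ⟨_, hAΛ⟩
  have hterm : ∀ g ∈ 𝒢, P.real (A ∩ I g) = regionFreeReal d p q g A * P.real (I g) := by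
    intro g hg
    rw [h𝒢, Finset.mem_filter, Finset.mem_powerset] at hg
    refine hP.real_inter_eq_regionFreeReal_mul_of_closed hE hp hq g (edgesIn (zdGraph d) Δ \ edgesIn (zdGraph d) g)
      (hAΛ.mono (edgesIn_subset_edgesIn_of_subset hg.2)) ?_ (determinedBy_setOf_island Δ g) ?_
    · rw [Finset.coe_sdiff]
      exact disjoint_sdiff_left
    · intro ω hω x hx y hy hxy
      exact not_mem_of_island hω hx hy hxy
  rw [setOf_forall_not_bdryReach_eq_biUnion hΛΔ, Set.inter_iUnion₂]
  change P.real (⋃ g ∈ 𝒢, A ∩ I g) = ∑ g ∈ 𝒢, regionFreeReal d p q g A * P.real (I g)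
  rw [measureReal_biUnion_finset hdisjA (fun g _ => hAm.inter (hIm g))]
  exact Finset.sum_congr rfl hterm

/-- **In a box, the free measure is maximal among DLR measures on `{Λ ↮ ∂Δ}`**: for `P ∈ R_{p,q}` carried by lattice
configurations (`0 < p < 1`, `q ≥ 1`), finite `Λ ⊆ Δ` and an increasing `A` determined by `E_Λ`,
`P(A ∩ {Λ ↮ ∂Δ inside Δ}) ≤ φ⁰_{p,q}(A ∩ {Λ ↮ ∂Δ inside Δ})`: both sides are integrals of the decreasing simple function
`Σ_g φ⁰_g(A) 1_{G = g}`, and `φ⁰_{p,q} ≤st P`. [cite: Grimmett2006, §5.2, Prop. (5.30) and the display after it, with Thm. (4.34) eq. (4.35)] -/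
theorem IsDLRRandomCluster.real_inter_setOf_forall_not_bdryReach_le_rcLimit_false (hP : IsDLRRandomCluster d p q P)
    (hE : ∀ᵐ ω ∂P, ω ⊆ (zdGraph d).edgeSet) (hp : p ∈ Set.Ioo (0 : ℝ) 1) (hq : 1 ≤ q) {Λ Δ : Finset (Site d)}
    (hΛΔ : Λ ⊆ Δ) {A : Set (BondConfig (Site d))} (hA : IsUpperSet A) (hAΛ : DeterminedBy A ↑(edgesIn (zdGraph d) Λ)) :
    P.real (A ∩ {ω | ∀ x ∈ Λ, ¬ ∃ y ∈ innerBoundary (zdGraph d) Δ,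
        (openGraph ω ⊓ withinGraph (zdGraph d) (↑Δ : Set (Site d))).Reachable y x}) ≤
      (rcLimit d false p q).real (A ∩ {ω | ∀ x ∈ Λ, ¬ ∃ y ∈ innerBoundary (zdGraph d) Δ,
        (openGraph ω ⊓ withinGraph (zdGraph d) (↑Δ : Set (Site d))).Reachable y x}) := by
  classical
  haveI := hP.isProbabilityMeasure
  haveI := isProbabilityMeasure_rcLimit false p q (d := d)
  have hp' : p ∈ Set.Icc (0 : ℝ) 1 := ⟨hp.1.le, hp.2.le⟩
  have hq0 : 0 < q := one_pos.trans_le hq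
  have hG : FKGibbs d p q P := hP.fkGibbs hp hq hE
  set f : BondConfig (Site d) → ℝ := fun ω =>
    ∑ g ∈ Δ.powerset.filter (fun g => Λ ⊆ g),
      {ω : BondConfig (Site d) | ∀ x, x ∈ g ↔ x ∈ Δ ∧ ¬ ∃ y ∈ innerBoundary (zdGraph d) Δ,
        (openGraph ω ⊓ withinGraph (zdGraph d) (↑Δ : Set (Site d))).Reachable y x}.indicator
        (fun _ => regionFreeReal d p q g A) ω with hf
  -- `∫ (-f) dφ⁰ ≤ ∫ (-f) dP`, i.e. `∫ f dP ≤ ∫ f dφ⁰`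
  have hanti : Antitone f := antitone_sum_indicator_island hp' hq Λ Δ hA
  have hmono : Monotone fun ω => -f ω := fun ω ω' h => neg_le_neg (hanti h)
  have hmeas : Measurable fun ω => -f ω := (measurable_sum_indicator_island p q Λ Δ A).neg
  have hbdd : ∀ ω, |-f ω| ≤ 1 := fun ω => by
    rw [abs_neg]
    exact abs_sum_indicator_island_le_one hp' hq0 Λ Δ A ω
  have hint := hG.integral_rcLimit_false_le hp' hq hmono hmeas hbdd
  rw [integral_neg, integral_neg, neg_le_neg_iff] at hint
  rw [hP.real_inter_setOf_forall_not_bdryReach_eq_sum hE hp hq0 hΛΔ hAΛ,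
    (isBoxLimit_rcLimit false hp' hq).real_inter_setOf_forall_not_bdryReach_eq_sum hp' hq0 hΛΔ hAΛ,
    ← integral_sum_indicator_island, ← integral_sum_indicator_island]
  exact hint

/-- **On finite clusters the free measure is the LARGEST DLR measure**: for `P ∈ R_{p,q}` carried by lattice configurations
(`0 < p < 1`, `q ≥ 1`), every finite `Λ` and every increasing `A` determined by `E_Λ`,
`P(A ∩ {∀ x ∈ Λ, |C_x| < ∞}) ≤ φ⁰_{p,q}(A ∩ {∀ x ∈ Λ, |C_x| < ∞})`. [cite: Grimmett2006, §5.2, Prop. (5.30) and the proof of Thm. (5.16)(c), eq. (5.28)] -/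
theorem IsDLRRandomCluster.real_inter_finiteClusters_le_rcLimit_false (hP : IsDLRRandomCluster d p q P)
    (hE : ∀ᵐ ω ∂P, ω ⊆ (zdGraph d).edgeSet) (hp : p ∈ Set.Ioo (0 : ℝ) 1) (hq : 1 ≤ q) {Λ : Finset (Site d)}
    {A : Set (BondConfig (Site d))} (hA : IsUpperSet A) (hAΛ : DeterminedBy A ↑(edgesIn (zdGraph d) Λ)) :
    P.real (A ∩ {ω | ∀ x ∈ Λ, ω ∉ percolatesAt x}) ≤
      (rcLimit d false p q).real (A ∩ {ω | ∀ x ∈ Λ, ω ∉ percolatesAt x}) := by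
  haveI := hP.isProbabilityMeasure
  haveI := isProbabilityMeasure_rcLimit false p q (d := d)
  have hp' : p ∈ Set.Icc (0 : ℝ) 1 := ⟨hp.1.le, hp.2.le⟩
  have hAm : MeasurableSet A := measurableSet_of_isLocalEvent_holds ⟨_, hAΛ⟩
  have h1 := tendsto_real_inter_setOf_forall_not_bdryReach P hE hAm Λ
  have h2 := tendsto_real_inter_setOf_forall_not_bdryReach (rcLimit d false p q)
    ((isBoxLimit_rcLimit false hp' hq).ae_subset_edgeSet hp' (one_pos.trans_le hq)) hAm Λ
  refine le_of_tendsto_of_tendsto h1 h2 ?_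
  filter_upwards [eventually_ge_atTop (Λ.sup siteRad)] with n hn
  exact hP.real_inter_setOf_forall_not_bdryReach_le_rcLimit_false hE hp hq (subset_box_of_sup_siteRad_le hn) hA hAΛ

/-- **The reversed sandwich on finite clusters**: for `P ∈ R_{p,q}` carried by lattice configurations (`0 < p < 1`, `q ≥ 1`),
finite `Λ` and increasing `A` determined by `E_Λ`,
`φ¹_{p,q}(A ∩ {Λ ↛ ∞}) ≤ P(A ∩ {Λ ↛ ∞}) ≤ φ⁰_{p,q}(A ∩ {Λ ↛ ∞})` — inside finite clusters the wired measure is the smallest and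
the free measure the largest member of the class. [cite: Grimmett2006, §5.2, Prop. (5.30), with Thm. (4.34) eq. (4.35)] -/
theorem IsDLRRandomCluster.real_inter_finiteClusters_mem_Icc (hP : IsDLRRandomCluster d p q P)
    (hE : ∀ᵐ ω ∂P, ω ⊆ (zdGraph d).edgeSet) (hp : p ∈ Set.Ioo (0 : ℝ) 1) (hq : 1 ≤ q) {Λ : Finset (Site d)}
    {A : Set (BondConfig (Site d))} (hA : IsUpperSet A) (hAΛ : DeterminedBy A ↑(edgesIn (zdGraph d) Λ)) :
    P.real (A ∩ {ω | ∀ x ∈ Λ, ω ∉ percolatesAt x}) ∈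
      Set.Icc ((rcLimit d true p q).real (A ∩ {ω | ∀ x ∈ Λ, ω ∉ percolatesAt x}))
        ((rcLimit d false p q).real (A ∩ {ω | ∀ x ∈ Λ, ω ∉ percolatesAt x})) :=
  ⟨(hP.fkGibbs hp hq hE).rcLimit_true_real_inter_finiteClusters_le ⟨hp.1.le, hp.2.le⟩ hq hA hAΛ,
    hP.real_inter_finiteClusters_le_rcLimit_false hE hp hq hA hAΛ⟩

end Summit.CriticalPhenomena.PercolationContinuityZ3.Theorems.FK

end
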